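import Summits.BirchSwinnertonDyer.BirchSwinnertonDyer.Theorems.ResidualThetaTransportAtTwoSignedMuSeedAtTwoPlusTiltRecursion
import HarnessLib

/-!
# Seed crux `SignedMuSeedAtTwoPlus` (stmt-BirchSwinnertonDyer-21438), line `norm-field-tilt`:
# the NEGATIVE CONTROL of the tilt engine — coboundary norms are degenerate at every level

Cell `bsd-wall`, width seat `bsd-wall-rtt-p4-w2` g10; third file on the line's power-series algebra, on top of
p656802 (`…TiltRecursion`: `D∘D = 0`, `D S = S²`, Taylor, the CLAIM).  HONEST FRAMING: THEOREMS ONLY; pure algebra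
over a commutative ring of characteristic `2`; closes no item; the line is NOT registered; BSD is NOT proved by this.

## What is proved

The line card (`Cruxes/SignedMuSeedAtTwoPlus/Lines/norm-field-tilt.md`, S4 and the S4 probe) records two facts about
`𝒰^±`-COBOUNDARIES `θ = F·(F∘[g])` (a norm that is a square up to the two end factors): "total degeneracy
characterises coboundaries (margin exactly `2·ord(Φ) + 2` at every level)" and "the engine has a built-in NEGATIVE
control: it recognises a square norm … no odd digit ever".  Here, in the abstract currency of p656802
(`D = u·d/dt`, translation `φ = t + u·y + y²·r`, invariance `u·φ' = u∘φ`):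

* `logDeriv_sq` — `D log` of a square vanishes in characteristic `2` (`u·(G²)' = 0`), and `logDeriv_unique` —
  over a domain `Z ≠ 0` has at most one `S` with `Z·S = u·Z'`;
* `logDeriv_coboundary` — if `F·Φ = u·F'` then `Z := F·(F∘φ)·G²` satisfies `Z·(Φ + Φ∘φ) = u·Z'`: the `D log` of
  a coboundary norm is `Φ + Φ∘φ` whatever the square part `G²` (so, by uniqueness, `S_m = Φ + Φ(t ⊕ y_m)` — the
  card's "coboundary control" formula);
* `le_order_add_subst_of_sq` — for ANY `Φ` with `D Φ = Φ²` and `w ≤ ord Φ`, `1 ≤ N ≤ ord y`: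
  `min (2w + N) (2N + w − 2) ≤ ord (Φ + Φ∘φ)`; hence `coboundary_not_nonDeg`: `N − 2 ≤ ord (Φ + Φ∘φ)`, i.e. the
  non-degeneracy `NonDeg` (`ord S + 2 < N`) FAILS AT EVERY LEVEL for a coboundary — the negative control;
* `coboundary_margin` — if moreover `ord Φ = w` with `w + 2 < N` (over a domain) then `ord (Φ + Φ∘φ) = 2w + N`
  exactly (p656802's CLAIM read for `Φ`): the degeneracy margin `ord S + 2 − N` is the constant `2w + 2`
  ("margin exactly `2·ord(Φ)+2` at every level"; calibration: `w = 4`, `v = 8 + 4^{m+1}`).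

[folklore]
-/

noncomputable section

set_option autoImplicit false
set_option linter.dupNamespace false

open PowerSeries

namespace Summit.BirchSwinnertonDyer.BirchSwinnertonDyer.Theorems.SignedMuAtTwo.Tilt

variable {k : Type*} [CommRing k]

/-- Over a domain, `Z ≠ 0` has at most one `D`-logarithmic derivative: `Z·S₁ = u·Z' = Z·S₂ ⟹ S₁ = S₂`.
[folklore] -/
theorem logDeriv_unique [NoZeroDivisors k] {u Z S₁ S₂ : PowerSeries k} (hZ : Z ≠ 0)
    (h₁ : Z * S₁ = u * d⁄dX k Z) (h₂ : Z * S₂ = u * d⁄dX k Z) : S₁ = S₂ :=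
  mul_left_cancel₀ hZ (h₁.trans h₂.symm)

section CharTwo

variable [CharP k 2]

/-- In characteristic `2` the `D log` of a square vanishes: `u·(G²)' = u·2GG' = 0`, written as the `D log`
relation `G²·0 = u·(G²)'`. [folklore] -/
theorem logDeriv_sq (u G : PowerSeries k) : G ^ 2 * 0 = u * d⁄dX k (G ^ 2) := by
  rw [mul_zero, pow_two, Derivation.leibniz, smul_eq_mul, add_self_eq_zero, mul_zero]

/-- **`D log` of a coboundary norm.**  If `F·Φ = u·F'` (`Φ = D log F`) and the translation `φ` (`φ(0) = 0`)
preserves `dt/u` (`u·φ' = u∘φ`), then for every `G` the series `Z = F·(F∘φ)·G²` has `D log Z = Φ + Φ∘φ`: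
`Z·(Φ + Φ∘φ) = u·Z'`.  In the line: `Z'_{ρ,m} = ∏_{j<2^m} θ([g^j]t)` with `θ = F·(F∘[g])` equals
`F·(F∘[h_m])·(∏_{0<j<2^m} F∘[g^j])²`. [folklore] -/
theorem logDeriv_coboundary {u φ F Φ : PowerSeries k} (hφ : constantCoeff φ = 0)
    (hinv : u * d⁄dX k φ = u.subst φ) (hF : F * Φ = u * d⁄dX k F) (G : PowerSeries k) :
    (F * F.subst φ * G ^ 2) * (Φ + Φ.subst φ) = u * d⁄dX k (F * F.subst φ * G ^ 2) := by
  have h := logDeriv_mul (logDeriv_levelStep hφ hinv hF) (logDeriv_sq u G)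
  rwa [add_zero] at h

/-- **Coboundary control, the formula.**  Over a domain: if `Z = F·(F∘φ)·G² ≠ 0` and `Z·S = u·Z'`, then
`S = Φ + Φ∘φ` (`Φ = D log F`).  This is the card's "for `F = θ̄^ρ·θ̄^ρ∘[g]` the sums are `Φ_ρ + Φ_ρ(t̄ ⊕ y_m)`".
[folklore] -/
theorem logDeriv_eq_add_subst_of_coboundary [NoZeroDivisors k] {u φ F Φ G Z S : PowerSeries k}
    (hφ : constantCoeff φ = 0) (hinv : u * d⁄dX k φ = u.subst φ) (hF : F * Φ = u * d⁄dX k F)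
    (hZ : Z = F * F.subst φ * G ^ 2) (hZ0 : Z ≠ 0) (hS : Z * S = u * d⁄dX k Z) :
    S = Φ + Φ.subst φ := by
  subst hZ
  exact logDeriv_unique hZ0 hS (logDeriv_coboundary hφ hinv hF G)

/-- **Order of `Φ + Φ∘φ` from below, no non-degeneracy assumed.**  `D Φ = Φ²`, `φ = t + u·y + y²·r`,
`w ≤ ord Φ`, `1 ≤ N ≤ ord y` ⟹ `min (2w + N) (2N + w − 2) ≤ ord (Φ + Φ∘φ)`
(`Φ + Φ(t ⊕ y) = Φ²·y + Φ'·y²r + TaylorRemainder`). [folklore] -/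
theorem le_order_add_subst_of_sq {u Φ y r φ : PowerSeries k} {w N : ℕ}
    (hD : u * d⁄dX k Φ = Φ ^ 2) (hφ : φ = X + u * y + y ^ 2 * r)
    (hw : (w : ℕ∞) ≤ Φ.order) (hN : 1 ≤ N) (hy : (N : ℕ∞) ≤ y.order) :
    ((min (2 * w + N) (2 * N + w - 2) : ℕ) : ℕ∞) ≤ PowerSeries.order (Φ + (Φ.subst φ : PowerSeries k)) := by
  have h0 : ((0 : ℕ) : ℕ∞) ≤ u.order := by simp
  have hr : ((0 : ℕ) : ℕ∞) ≤ r.order := by simp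
  have hδ : (N : ℕ∞) ≤ (u * y + y ^ 2 * r).order := by
    refine le_order_add_of_le ?_ ?_
    · simpa using le_order_mul_of_le h0 hy
    · rw [pow_two]
      exact le_trans (by exact_mod_cast (by omega)) (le_order_mul_of_le (le_order_mul_of_le hy hy) hr)
  have hφ' : φ = X + (u * y + y ^ 2 * r) := by rw [hφ]; ring
  have hE : Φ + (Φ.subst φ : PowerSeries k) = Φ ^ 2 * y + (d⁄dX k Φ * (y ^ 2 * r) +
      ((Φ.subst (X + (u * y + y ^ 2 * r)) : PowerSeries k) - Φ - d⁄dX k Φ * (u * y + y ^ 2 * r))) := by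
    rw [hφ']
    linear_combination add_self_eq_zero Φ + y * hD
  rw [hE]
  refine le_order_add_of_le ?_ (le_order_add_of_le ?_ ?_)
  · rw [pow_two]
    exact le_trans (by exact_mod_cast (by omega)) (le_order_mul_of_le (le_order_mul_of_le hw hw) hy)
  · rw [pow_two]
    exact le_trans (by exact_mod_cast (by omega))
      (le_order_mul_of_le (le_order_derivative hw) (le_order_mul_of_le (le_order_mul_of_le hy hy) hr))
  · exact le_trans (by exact_mod_cast (by omega)) (le_order_taylorRemainder (f := Φ) hN hδ hw)

/-- **Negative control: a coboundary is degenerate at every level.**  `D Φ = Φ²`, `φ = t + u·y + y²·r`,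
`1 ≤ N ≤ ord y` ⟹ `N − 2 ≤ ord (Φ + Φ∘φ)`; so the non-degeneracy `ord S + 2 < N` of stub S2/S4 never holds for
`S = Φ + Φ∘φ` — the engine "recognises a square norm (no odd digit, constant-margin degeneracy)". [folklore] -/
theorem coboundary_not_nonDeg {u Φ y r φ : PowerSeries k} {N : ℕ}
    (hD : u * d⁄dX k Φ = Φ ^ 2) (hφ : φ = X + u * y + y ^ 2 * r)
    (hN : 1 ≤ N) (hy : (N : ℕ∞) ≤ y.order) :
    ((N - 2 : ℕ) : ℕ∞) ≤ PowerSeries.order (Φ + (Φ.subst φ : PowerSeries k)) := by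
  have h0 : ((0 : ℕ) : ℕ∞) ≤ Φ.order := by simp
  exact le_trans (by exact_mod_cast (by omega)) (le_order_add_subst_of_sq (w := 0) hD hφ h0 hN hy)

/-- The same in the line's `NonDeg` wording: for a coboundary `S = Φ + Φ∘φ` it is FALSE that `ord S + 2 < N`.
[folklore] -/
theorem not_order_add_two_lt_of_coboundary {u Φ y r φ : PowerSeries k} {N : ℕ}
    (hD : u * d⁄dX k Φ = Φ ^ 2) (hφ : φ = X + u * y + y ^ 2 * r)
    (hN : 1 ≤ N) (hy : (N : ℕ∞) ≤ y.order) :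
    ¬ PowerSeries.order (Φ + (Φ.subst φ : PowerSeries k)) + 2 < (N : ℕ∞) := by
  intro h
  have hle := coboundary_not_nonDeg hD hφ hN hy
  generalize PowerSeries.order (Φ + (Φ.subst φ : PowerSeries k)) = o at h hle
  induction o using ENat.recTopCoe with
  | top => simp at h
  | coe a =>
    have h1 : a + 2 < N := by exact_mod_cast h
    have h2 : N - 2 ≤ a := by exact_mod_cast hle
    omega

/-- **The constant margin of a coboundary.**  Over a domain: `D Φ = Φ²`, `φ = t + u·y + y²·r`, `ord Φ = w`,
`ord y = N`, `w + 2 < N` ⟹ `ord (Φ + Φ∘φ) = 2w + N` (p656802's CLAIM for `Φ`), i.e. the degeneracy margin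
`ord S + 2 − N = 2w + 2` is the same at every level (card: "margin exactly `2·ord(Φ)+2`"; calibration class
`w = 4`: `v(S_m) = 8 + 4^{m+1}`). [folklore] -/
theorem coboundary_margin [NoZeroDivisors k] {u Φ y r φ : PowerSeries k} {w N : ℕ}
    (hD : u * d⁄dX k Φ = Φ ^ 2) (hφ : φ = X + u * y + y ^ 2 * r)
    (hw : Φ.order = w) (hy : y.order = N) (hwN : w + 2 < N) :
    PowerSeries.order (Φ + (Φ.subst φ : PowerSeries k)) = (2 * w + N : ℕ) :=
  order_add_subst_eq hD hφ hw hy hwN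

end CharTwo

end Summit.BirchSwinnertonDyer.BirchSwinnertonDyer.Theorems.SignedMuAtTwo.Tilt

end
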